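import Summits.Parity.GeneralizedHardyLittlewood.Theorems.PolymathEpsThreeCeilingGridBoundHighOfR1
import Summits.Parity.GeneralizedHardyLittlewood.Theorems.PolymathEpsThreeCeilingGridBoundHighR1Part01
import Summits.Parity.GeneralizedHardyLittlewood.Theorems.PolymathEpsThreeCeilingGridBoundHighR1Part02
import Summits.Parity.GeneralizedHardyLittlewood.Theorems.PolymathEpsThreeCeilingGridBoundHighR1Part03
import Summits.Parity.GeneralizedHardyLittlewood.Theorems.PolymathEpsThreeCeilingGridBoundHighR1Part04
import Summits.Parity.GeneralizedHardyLittlewood.Theorems.PolymathEpsThreeCeilingGridBoundHighR1Part05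
import Summits.Parity.GeneralizedHardyLittlewood.Theorems.PolymathEpsThreeCeilingGridBoundHighR1Part06
import Summits.Parity.GeneralizedHardyLittlewood.Theorems.PolymathEpsThreeCeilingGridBoundHighR1Part07
import Summits.Parity.GeneralizedHardyLittlewood.Theorems.PolymathEpsThreeCeilingGridBoundHighR1Part08
import Summits.Parity.GeneralizedHardyLittlewood.Theorems.PolymathEpsThreeCeilingGridBoundHighR1Part09
import Summits.Parity.GeneralizedHardyLittlewood.Theorems.PolymathEpsThreeCeilingGridBoundHighR1Part10
import Summits.Parity.GeneralizedHardyLittlewood.Theorems.PolymathEpsThreeCeilingGridBoundHighR1Part11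
import Summits.Parity.GeneralizedHardyLittlewood.Theorems.PolymathEpsThreeCeilingGridBoundHighR1Part12
import Summits.Parity.GeneralizedHardyLittlewood.Theses.PolymathEpsThreeCeiling

/-!
# Route `PolymathEpsThreeCeiling`, crux `GridBoundHigh` (stmt-Parity-19069) — CLOSED: the registered stub
# `stub_cwCertsHigh` and the route crux `GridBoundHigh` by name

The 24 grid bounds `M_{3, j/80} ≤ 2(80+j)/(81+j)`, `17 ≤ j ≤ 40`, for every Polymath test function (`k = 3`).
Chain (all in the tree): the proved Cauchy–Schwarz weight checker `polymathFunctional_le_of_weights (n := 2)`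
(`Literature.NumberTheory.Sieve.PolymathMkEpsCauchySchwarz`) ⟸ the rank/activity five-constant weight certificates
(`…GridBoundHighRankActivity*.lean`, `…FiveTables.lean`, `…OfR1.lean`: `RankActivity.gridBoundHigh_of_R1`,
`RankActivity.stub_cwCertsHigh_of_R1` reduce everything to the 24 two-variable real inequalities "R1 at `j`":
`fiveBudget (j/80) … s₀ s₁ ≤ 1`) ⟸ `RankActivity.R1_17 … R1_40` (`…GridBoundHighR1Part01 … Part12.lean`: kernel-checked
bivariate Taylor-model range certificates, `Literature.Analysis.ValidatedNumerics.TaylorModelRangeCert2D`, over the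
programs of `…GridBoundHighR1Terms.lean`).  This file only assembles: `RankActivity.R1_all`, then
`stub_cwCertsHigh` (the registered stub of skeleton `Cruxes/GridBoundHigh/Lines/birth.lean`, VERBATIM) and
`gridBoundHigh_proof : Summit.Parity.GeneralizedHardyLittlewood.Theses.PolymathEpsThreeCeiling.GridBoundHigh`.
Closing one crux of route `PolymathEpsThreeCeiling`; nothing here proves the Parity summit.  Standard axioms
(`propext`, `Classical.choice`, `Quot.sound`; every certificate is `decide +kernel`, no `native_decide`).
-/

noncomputable section

open Finset MeasureTheory Set

namespace Summit.Parity.GeneralizedHardyLittlewood.Theses.PolymathEpsThreeCeiling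

namespace RankActivity

/-- **The 24 real inequalities R1 at `j`, `17 ≤ j ≤ 40`** (fibre budget of the tabulated five-constant rank/activity
certificate `≤ 1` on the generic outer pairs `0 < s₁ ≤ s₀`, `s₀ + s₁ ≤ 1 - j/80`). -/
theorem R1_all : ∀ j : ℕ, 17 ≤ j → j ≤ 40 → (∀ s₀ s₁ : ℝ, 0 < s₁ → s₁ ≤ s₀ → s₀ + s₁ ≤ 1 - (j : ℝ) / 80 →
    fiveBudget ((j : ℝ) / 80) (2 * (80 + (j : ℝ)) / (81 + (j : ℝ))) (betaT j) (d10T j) (d0T j) (cT j) s₀ s₁ ≤ 1) := by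
  intro j hj1 hj2
  interval_cases j
  · exact R1_17
  · exact R1_18
  · exact R1_19
  · exact R1_20
  · exact R1_21
  · exact R1_22
  · exact R1_23
  · exact R1_24
  · exact R1_25
  · exact R1_26
  · exact R1_27
  · exact R1_28
  · exact R1_29
  · exact R1_30
  · exact R1_31
  · exact R1_32
  · exact R1_33
  · exact R1_34
  · exact R1_35
  · exact R1_36
  · exact R1_37
  · exact R1_38
  · exact R1_39
  · exact R1_40

end RankActivity

/-- **The registered stub `stub_cwCertsHigh` of the skeleton `Cruxes/GridBoundHigh/Lines/birth.lean` (VERBATIM)**: for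
every grid point `j = 17 … 40` an explicit, `F`-independent Cauchy–Schwarz weight certificate at
`(ε, M) = (j/80, 2(80+j)/(81+j))` — measurable weights, positive on the active region, fibre budgets `≤ 1`, pointwise
sum `≤ M` (the data of `polymathFunctional_le_of_weights (n := 2)`). -/
theorem stub_cwCertsHigh :
    ∀ j : ℕ, 17 ≤ j → j ≤ 40 →
      ∃ w : Fin 3 → (Fin 3 → ℝ) → ℝ, (∀ m, Measurable (w m)) ∧
        (∀ m (t : Fin 3 → ℝ), 0 < t m → ∑ i ∈ univ.erase m, t i ≤ 1 - (j : ℝ) / 80 → 0 < w m t) ∧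
        (∀ m (s : Fin 2 → ℝ), (∀ i, 0 ≤ s i) → ∑ i, s i ≤ 1 - (j : ℝ) / 80 →
          ∫⁻ u in Ioc (0:ℝ) (1 + (j : ℝ) / 80 - ∑ i, s i), ENNReal.ofReal (w m (Fin.insertNth m u s))⁻¹ ≤ 1) ∧
        (∀ t : Fin 3 → ℝ, (∀ i, 0 ≤ t i) → ∑ i, t i ≤ 1 + (j : ℝ) / 80 →
          ∑ m, (if 0 < t m ∧ ∑ i ∈ univ.erase m, t i ≤ 1 - (j : ℝ) / 80 then w m t else 0) ≤
            2 * (80 + (j : ℝ)) / (81 + (j : ℝ))) :=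
  RankActivity.stub_cwCertsHigh_of_R1 RankActivity.R1_all

/-- **The route crux `GridBoundHigh` (stmt-Parity-19069), by name**: for every integer `17 ≤ j ≤ 40` and every Polymath
test function `F` at `ε = j/80` (`k = 3`), `(Σᵢ J_{i,1-ε}(F)) / I(F) ≤ 2(80+j)/(81+j)`. -/
theorem gridBoundHigh_proof : Summit.Parity.GeneralizedHardyLittlewood.Theses.PolymathEpsThreeCeiling.GridBoundHigh :=
  RankActivity.gridBoundHigh_of_R1 RankActivity.R1_all

end Summit.Parity.GeneralizedHardyLittlewood.Theses.PolymathEpsThreeCeiling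

end
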